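import Summits.BirchSwinnertonDyer.BirchSwinnertonDyer.Theorems.KatoDescentPotSupersingularWildFineSelmerOrdinaryUnitAnchor
import Literature.NumberTheory.EllipticCurves.BSDRootNumber
import Literature.NumberTheory.EllipticCurves.BSDRootNumberSmallConductorProofs
import HarnessLib

/-!
# Route `KatoDescentPotSupersingular` (rung K9, cell `bsd-potss`): SMALL-CONDUCTOR unit anchors for the
# Conj-A crux `WildFineSelmerCoatesSujatha` (item stmt-BirchSwinnertonDyer-19386) — the `Ш`-certificate of
# a good-ordinary unit anchor of conductor `< 5000` read off Creutz–Miller's theorem (bsd.S31) and ONE exact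
# `L`-value datum; ROUTE-FREE (a `--supports … --as helper` file; seat `bsd-potss-k9-c4` g4; nothing
# booked, BSD is not proved by any of this, item 19386 is NOT closed)

The unit-anchor road (`…WildFineSelmerOrdinaryUnitAnchor.lean`, p457401) needs, at the anchor `W′`, the
integer `#Ш(E′/ℚ)[3^∞] = 1`. In the K9 anchor census (k8t-c4 g4, `HOME/k8t-c4/K9-19386-anchor-census-g4.tsv`)
the ♯ rows with a data-level unit anchor are served by the curves 338d1 (seven rows) and 6845b1 (one row);
for an anchor of conductor `< 5000` and rank `≤ 1` the full BSD formula is a PUBLISHED (computer-assisted)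
theorem — Creutz–Miller 2012 Thm. 1.1 completing Miller 2011 / Miller–Stoll 2013, repaired by
Lawson–Wuthrich 2016 (tree fact `bsdTriple_of_rank_le_one_of_conductor_lt`, bsd.S31) — so `#Ш(E′)` IS the
analytic order `Ш_an(E′) = L(E′,1)·#tors²/(Ω·Tam)`, an exact rational of record (modular symbols). This
file records that reading:

* `natCard_sha_eq_of_conductor_lt_of_shaAn_eq` — `N_{E′} < 5000`, `rank E′(ℚ) ≤ 1`, `Ш_an(E′) = m ∈ ℕ`
  ⟹ `Ш(E′)` finite and `#Ш(E′) = m` (bsd.S31 + `bsdLeadingTermFormula_iff_shaAn_eq`);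
* `missingUpperBoundAt_wild_of_smallConductorUnitAnchor` — the per-row road with the anchor's data in
  the form: `ModPCongruent W′ W 3`, good ordinary at `3`, `N_{E′} < 5000`, `rank E′(ℚ) = 0`,
  `Ш_an(E′) = m` with `3 ∤ m`, `3 ∤ #E′(ℚ)_tors · ∏ c_ℓ(E′) · #Ẽ′(𝔽₃)` — below {LS18, Kato fine-Selmer
  p420034, Perrin-Riou–Schneider, GZK, modularity, bsd.S31}.

CONDITIONAL on the displayed named facts; no definition, no new fact, no census number is an input.

References: [CreutzMiller2012] Thm. 1.1; [Miller2011LMS] Thm. 1.2; [LawsonWuthrich2016] §5;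
[GreenbergLNM1716] Thm. 4.1; [LimSujatha2018] §3 Prop. 3.2; [BalakrishnanMullerStein2015] Thm. 1.7.
-/

set_option autoImplicit false
-- sibling precedent (`KatoDescentPotSupersingularAssembly.lean`): the directory name repeats the summit name
set_option linter.dupNamespace false

noncomputable section

open scoped Classical

namespace Summit.BirchSwinnertonDyer.BirchSwinnertonDyer.Theorems.WildFineSelmerSmallConductorAnchor

open WeierstrassCurve Literature.NumberTheory.EllipticCurves
  Literature.NumberTheory.EllipticCurves.Rank1Residual
  Literature.NumberTheory.EllipticCurves.Rank1Residual.Typed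
  Summit.BirchSwinnertonDyer.Rank1Residual Summit.BirchSwinnertonDyer.Rank1Residual.Additive
  Summit.BirchSwinnertonDyer.Rank1Residual.O6
  Summit.BirchSwinnertonDyer.BirchSwinnertonDyer.Theorems

/-- **`#Ш(E) = Ш_an(E)` for `N_E < 5000`, `rank E(ℚ) ≤ 1`** (Creutz–Miller 2012 Thm. 1.1, tree fact
bsd.S31 `bsdTriple_of_rank_le_one_of_conductor_lt`, hypothesis `hS31`): if moreover `Ш_an(E) = m` for a
natural number `m`, then `Ш(E/ℚ)` is finite of order `m` (the LEAD clause through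
`bsdLeadingTermFormula_iff_shaAn_eq`). [cite: CreutzMiller2012, Thm 1.1]
[cite: Miller2011LMS, §1 and Thm 1.2 (arXiv:1010.2431 numbering)] -/
theorem natCard_sha_eq_of_conductor_lt_of_shaAn_eq (hS31 : bsdTriple_of_rank_le_one_of_conductor_lt)
    (W : WeierstrassCurve ℚ) [W.IsElliptic] [W.IsGloballyMinimal] (hr : W.mordellWeilRank ≤ 1)
    (hN : W.conductorNorm ℤ < 5000) {m : ℕ} (hm : shaAn W = (m : ℂ)) :
    Finite W.sha ∧ Nat.card W.sha = m := by
  obtain ⟨-, hfin, hlead⟩ := hS31 W hr hN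
  refine ⟨hfin, ?_⟩
  have h := (bsdLeadingTermFormula_iff_shaAn_eq W W.tamagawaProduct_pos_holds).mp hlead
  rw [hm] at h
  unfold WeierstrassCurve.shaOrder at h
  exact (Nat.cast_injective (R := ℂ) h).symm

/-- **The congruence road with a SMALL-CONDUCTOR good-ordinary unit anchor, row form.** Let `W/ℚ` be
a row of the Conj-A crux of route K9 (globally minimal, `r_an = 0`, `ClassO6 W 3`, `W[3]` irreducible)
and `W′/ℚ` a globally minimal curve with `W′[3] ≃ W[3]` (`O6.ModPCongruent W′ W 3`), good ordinary at
`3`, of conductor `N_{E′} < 5000` and rank `0`, with `Ш_an(E′) = m`, `3 ∤ m`, `3 ∤ #E′(ℚ)_tors`,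
`3 ∤ ∏ c_ℓ(E′)`, `3 ∤ #Ẽ′(𝔽₃)`. Then `ord₃ #Ш(E) ≤ ord₃ #Ш(E)_an` — below Lim–Sujatha (`hLS`),
Kato's fine-Selmer reading (`hKatoA`), Perrin-Riou–Schneider (`hPRS`), GZK (`hGZK`), modularity
(`hmod`) and Creutz–Miller (`hS31`). (`#Ш(E′)[3^∞] = 3^{v₃(#Ш(E′))} = 3^{v₃(m)} = 1`, then
`WildFineSelmerOrdinaryUnitAnchor.missingUpperBoundAt_wild_of_ordinaryUnitAnchor`.)
[cite: CreutzMiller2012, Thm 1.1] [cite: LimSujatha2018, §3 Prop. 3.2]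
[cite: GreenbergLNM1716, §4 Thm. 4.1 (p. 85)] -/
theorem missingUpperBoundAt_wild_of_smallConductorUnitAnchor
    (hLS : LimSujatha2018.prop32_fineSelmerDual_moduleFinite_iff_of_torsionIso)
    (hKatoA :
      Kato2004.rankZero_padicValNat_sha_add_padicValNat_tamagawa_le_of_additive_potGood_of_irreducible_of_fineSelmerDual_fg)
    (hPRS : Schneider1985_order_charGenerator_odd)
    (hGZK : rank_eq_analyticRank_of_analyticRank_le_one) (hmod : hasEntireLFunction_rat)
    (hS31 : bsdTriple_of_rank_le_one_of_conductor_lt)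
    (W : WeierstrassCurve ℚ) [W.IsElliptic] [W.IsGloballyMinimal] [Fact (3 : ℕ).Prime]
    (hr : W.analyticRank = 0) (hO : ClassO6 W 3) (hirr : W.HasIrreducibleModPGaloisRep 3)
    (W' : WeierstrassCurve ℚ) [W'.IsElliptic] [W'.IsGloballyMinimal] (hcong : ModPCongruent W' W 3)
    (hgood' : W'.HasGoodReductionAtPrime 3) (hord' : ¬ (3 : ℤ) ∣ W'.frobeniusTrace 3)
    (hN' : W'.conductorNorm ℤ < 5000) (hrank' : W'.mordellWeilRank = 0)
    {m : ℕ} (hshaAn' : shaAn W' = (m : ℂ)) (hm : ¬ 3 ∣ m)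
    (htors' : ¬ 3 ∣ W'.torsionOrder) (htam' : ¬ 3 ∣ W'.tamagawaProduct)
    (hNp' : ¬ 3 ∣ W'.reductionPointCount 3) :
    MissingUpperBoundAt W 3 := by
  obtain ⟨hfin, hcard⟩ :=
    natCard_sha_eq_of_conductor_lt_of_shaAn_eq hS31 W' (by rw [hrank']; exact zero_le_one) hN' hshaAn'
  haveI : Finite W'.sha := hfin
  have hsha' : Nat.card (AddCommGroup.primaryComponent W'.sha 3) = 1 := by
    rw [card_addPrimaryComponent_eq_pow 3, hcard, Nat.factorization_eq_zero_of_not_dvd hm, pow_zero]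
  exact WildFineSelmerOrdinaryUnitAnchor.missingUpperBoundAt_wild_of_ordinaryUnitAnchor hLS hKatoA hPRS hGZK
    hmod W hr hO hirr W' hcong hgood' hord' hrank' hsha' htors' htam' hNp'

end Summit.BirchSwinnertonDyer.BirchSwinnertonDyer.Theorems.WildFineSelmerSmallConductorAnchor

end
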